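import Summits.QuantumFields.YangMills.Theorems.DirichletWindowFixedDistanceLowerPsdTransfer
import Summits.QuantumFields.YangMills.Theorems.DirichletWindowLocalGaussianityAxialKernel
import HarnessLib

/-!
# Stub `stub_kernelLower` of line «exp-moment tangent law» (item stmt-QuantumFields-12314, `DirichletWindow.LocalGaussianity`)

Registered stub 3 of the skeleton `Cruxes/LocalGaussianity/Lines/expmoment_tangent.lean`:
`FixedDistanceLowerPsdTransfer.KernelLower` — `∃ κ' > 0, ∃ n₀ ≥ 1, ∀ n ≥ n₀, κ'/n⁴ ≤ |kernel01 n|` for the in-plane axial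
lattice-Maxwell plaquette kernel `kernel01 n = curvatureTwoPoint (0;0,1) (n e₀;0,1)` (also INPUT 4 of the LINE-1 reduction
`fixedDistanceLower_of`, p597157).  Proof: the route-independent module `DirichletWindowLocalGaussianityAxialKernel`
(`AxialKernel.abs_curvatureTwoPoint_inPlane_ge`: `|c'_n| = c_n ≥ κ₀/n⁴` for `n ≥ 1`, `κ₀ = (2/3)(2π)⁻³/32768`, from
`c'_n = −c_n`, the Källén–Lehmann representation of `c_n` and a polynomial lower bound for the KL integral), rewritten to
the notation `axis`, `p01`, `kernel01` of `FixedDistanceLowerPsdTransfer`.  [folklore]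
-/

set_option autoImplicit false

noncomputable section

open Literature.MathematicalPhysics.QuantumFieldTheory Literature.Probability.LatticeModels
open Summit.QuantumFields.YangMills.Theorems.FixedDistanceLowerPsdTransfer (axis p01 kernel01 KernelLower)
open Summit.QuantumFields.YangMills.Theorems.LocalGaussianityExpMomentTangentLaw

namespace Summit.QuantumFields.YangMills.Cruxes.LocalGaussianity.ExpMomentTangentLaw

/-- The axial site `n e₀` of `FixedDistanceLowerPsdTransfer` is `Pi.single 0 n`. -/
theorem axis_eq_single (n : ℕ) : axis n = (Pi.single (0 : Fin 4) (n : ℤ) : Site 4) := by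
  ext i
  simp [axis, Pi.single_apply]

/-- **STUB 3 `stub_kernelLower`** (registered signature): `|kernel01 n| ≥ κ'/n⁴` for `n ≥ 1`, with
`κ' = (2/3)(2π)⁻³/32768`. -/
theorem stub_kernelLower : KernelLower := by
  refine ⟨2 / 3 / (2 * Real.pi) ^ 3 / 32768, by positivity, 1, le_rfl, fun n hn => ?_⟩
  have h := AxialKernel.abs_curvatureTwoPoint_inPlane_ge n hn
  unfold kernel01 p01
  rw [axis_eq_single]
  exact h

end Summit.QuantumFields.YangMills.Cruxes.LocalGaussianity.ExpMomentTangentLaw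

end
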